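import Literature.Geometry.Symplectic.AdjunctionEmbeddedSpheres
import HarnessLib

/-!
# Reduction of `adjunction_embedded_of_somewhereInjective_sphere` to its two published halves

`Literature.Geometry.Symplectic.adjunction_embedded_of_somewhereInjective_sphere` (Wendl 2018,
Cor. 2.52 with Thm. 2.51, plus the tubular neighbourhood theorem) is the conjunction of two
independent published statements, both kept here as explicit HYPOTHESES (no new named fact is
introduced; this file is debt-neutral):

* `(C1)` **Wendl 2020, Cor. 2.9 = Wendl 2018, Cor. 2.52, genus 0**: in an almost complex
  4-manifold, a somewhere injective `J`-sphere whose glued map is homotopic to that of an EMBEDDED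
  `J`-sphere is embedded — no normal-bundle hypothesis is needed for this half
  (adjunction formula `[u] · [u] = 2δ(u) + c_N(u)`, Wendl 2020 Thm. 2.8, App. B);
* `(C2)` **transfer of a trivial-normal-bundle witness along a homotopy of embedded spheres**
  (differential topology: `e(ν_Σ) = [Σ] · [Σ]` is homotopy invariant, oriented plane bundles over
  `S²` are classified by the Euler number, tubular neighbourhood theorem — Lee 2013 Thm. 6.24;
  Gompf–Stipsicz 1999 §1.2; Milnor–Stasheff §14): if `S` and `C` are embedded smooth two-chart
  spheres with homotopic glued maps in an almost complex (hence oriented) 4-manifold and `S` is cut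
  out by a submersion `π` on an open `N ⊇ S`, then `C` is cut out by a submersion `π'` on an open
  `N' ⊇ C`.

The theorem `adjunction_embedded_of_somewhereInjective_sphere_of_parts` is the (15-line) glue:
`T` follows from `(C1)` and `(C2)`. It records, kernel-checked, the decomposition written in the
fact seat's census; it does NOT discharge the fact.

## References

* C. Wendl, *Holomorphic Curves in Low Dimensions*, LNM 2216 (2018), Thm. 2.51, Cor. 2.52. [Wendl2018]
* C. Wendl, *Lectures on Contact 3-Manifolds, Holomorphic Curves and Intersection Theory*,
  Cambridge Tracts 220 (2020), Thm. 2.8, Cor. 2.9, App. B. [Wendl2020]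
* J. M. Lee, *Introduction to Smooth Manifolds*, 2nd ed. (2013), Thm. 6.24. [LeeSmoothManifolds2013]
-/

noncomputable section

open scoped Manifold ContDiff Topology
open Set Function Literature.Topology.FourManifolds Literature.Topology.FourManifolds.ComplexProjectiveSpace

namespace Literature.Geometry.Symplectic

/-- **Glue: `adjunction_embedded_of_somewhereInjective_sphere` from its two halves.**
`hC1` is Wendl 2020 Cor. 2.9 (= Wendl 2018 Cor. 2.52) for spheres in two-chart form (embedded
`J`-sphere `S`, somewhere injective `J`-sphere `C` with homotopic glued map ⇒ `C` embedded);
`hC2` is the transfer of a trivial-normal-bundle witness between embedded two-chart spheres with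
homotopic glued maps. [cite: Wendl2018, Cor. 2.52 and Thm. 2.51] [cite: LeeSmoothManifolds2013, Thm. 6.24] -/
theorem adjunction_embedded_of_somewhereInjective_sphere_of_parts
    (hC1 : ∀ (X : Type) [TopologicalSpace X] [T2Space X] [SecondCountableTopology X]
      [ChartedSpace (EuclideanSpace ℝ (Fin 4)) X] [IsManifold (𝓡 4) ∞ X]
      (JX : AlmostComplexStructure (𝓡 4) ∞ X) (u₀ v₀ u v : ℂ → X)
      (F F₀ : C(ComplexProjectiveSpace 1, X)),
      ContMDiff 𝓘(ℝ, ℂ) (𝓡 4) ∞ u₀ → ContMDiff 𝓘(ℝ, ℂ) (𝓡 4) ∞ v₀ → (∀ z : ℂ, z ≠ 0 → v₀ z = u₀ z⁻¹) →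
      IsJHolomorphic (𝓡 4) (fun y => JX y) u₀ → IsJHolomorphic (𝓡 4) (fun y => JX y) v₀ →
      Injective u₀ → (∀ z, Injective (mfderiv 𝓘(ℝ, ℂ) (𝓡 4) u₀ z)) →
      Injective (mfderiv 𝓘(ℝ, ℂ) (𝓡 4) v₀ 0) → v₀ 0 ∉ range u₀ →
      ContMDiff 𝓘(ℝ, ℂ) (𝓡 4) ∞ u → ContMDiff 𝓘(ℝ, ℂ) (𝓡 4) ∞ v → (∀ z : ℂ, z ≠ 0 → v z = u z⁻¹) →
      IsJHolomorphic (𝓡 4) (fun y => JX y) u → IsJHolomorphic (𝓡 4) (fun y => JX y) v →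
      (∀ p, CoordNeZero 0 p → F p = u (affineCoordComplex 0 p 0)) →
      (∀ p, CoordNeZero 1 p → F p = v (affineCoordComplex 1 p 0)) →
      (∀ p, CoordNeZero 0 p → F₀ p = u₀ (affineCoordComplex 0 p 0)) →
      (∀ p, CoordNeZero 1 p → F₀ p = v₀ (affineCoordComplex 1 p 0)) →
      F.Homotopic F₀ →
      (∃ z₀ : ℂ, Injective (mfderiv 𝓘(ℝ, ℂ) (𝓡 4) u z₀) ∧ (∀ z, u z = u z₀ → z = z₀) ∧ v 0 ≠ u z₀) →
      Injective u ∧ (∀ z, Injective (mfderiv 𝓘(ℝ, ℂ) (𝓡 4) u z)) ∧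
        Injective (mfderiv 𝓘(ℝ, ℂ) (𝓡 4) v 0) ∧ v 0 ∉ range u)
    (hC2 : ∀ (X : Type) [TopologicalSpace X] [T2Space X] [SecondCountableTopology X]
      [ChartedSpace (EuclideanSpace ℝ (Fin 4)) X] [IsManifold (𝓡 4) ∞ X]
      (_JX : AlmostComplexStructure (𝓡 4) ∞ X) (u₀ v₀ : ℂ → X) (N : Set X) (π : X → ℂ)
      (u v : ℂ → X) (F F₀ : C(ComplexProjectiveSpace 1, X)),
      ContMDiff 𝓘(ℝ, ℂ) (𝓡 4) ∞ u₀ → ContMDiff 𝓘(ℝ, ℂ) (𝓡 4) ∞ v₀ → (∀ z : ℂ, z ≠ 0 → v₀ z = u₀ z⁻¹) →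
      Injective u₀ → (∀ z, Injective (mfderiv 𝓘(ℝ, ℂ) (𝓡 4) u₀ z)) →
      Injective (mfderiv 𝓘(ℝ, ℂ) (𝓡 4) v₀ 0) → v₀ 0 ∉ range u₀ →
      IsOpen N → range u₀ ∪ {v₀ 0} ⊆ N → ContMDiffOn (𝓡 4) 𝓘(ℝ, ℂ) ∞ π N →
      (∀ y ∈ N, Surjective (mfderiv (𝓡 4) 𝓘(ℝ, ℂ) π y)) →
      {y | y ∈ N ∧ π y = 0} = range u₀ ∪ {v₀ 0} →
      ContMDiff 𝓘(ℝ, ℂ) (𝓡 4) ∞ u → ContMDiff 𝓘(ℝ, ℂ) (𝓡 4) ∞ v → (∀ z : ℂ, z ≠ 0 → v z = u z⁻¹) →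
      Injective u → (∀ z, Injective (mfderiv 𝓘(ℝ, ℂ) (𝓡 4) u z)) →
      Injective (mfderiv 𝓘(ℝ, ℂ) (𝓡 4) v 0) → v 0 ∉ range u →
      (∀ p, CoordNeZero 0 p → F p = u (affineCoordComplex 0 p 0)) →
      (∀ p, CoordNeZero 1 p → F p = v (affineCoordComplex 1 p 0)) →
      (∀ p, CoordNeZero 0 p → F₀ p = u₀ (affineCoordComplex 0 p 0)) →
      (∀ p, CoordNeZero 1 p → F₀ p = v₀ (affineCoordComplex 1 p 0)) →
      F.Homotopic F₀ →
      ∃ (N' : Set X) (π' : X → ℂ), IsOpen N' ∧ range u ∪ {v 0} ⊆ N' ∧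
        ContMDiffOn (𝓡 4) 𝓘(ℝ, ℂ) ∞ π' N' ∧ (∀ y ∈ N', Surjective (mfderiv (𝓡 4) 𝓘(ℝ, ℂ) π' y)) ∧
        {y | y ∈ N' ∧ π' y = 0} = range u ∪ {v 0}) :
    adjunction_embedded_of_somewhereInjective_sphere := by
  intro X _ _ _ _ _ JX u₀ v₀ N π u v F F₀ hu₀ hv₀ hglue₀ hJu₀ hJv₀ hinj₀ himm₀ himm₀' hinf₀
    hN hSN hπ hsubm hzero hu hv hglue hJu hJv hF0 hF1 hF₀0 hF₀1 hhtp hsi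
  -- Part 1: embeddedness of `C = (u, v)` (Wendl 2020 Cor. 2.9)
  have h1 := hC1 X JX u₀ v₀ u v F F₀ hu₀ hv₀ hglue₀ hJu₀ hJv₀ hinj₀ himm₀ himm₀' hinf₀
    hu hv hglue hJu hJv hF0 hF1 hF₀0 hF₀1 hhtp hsi
  obtain ⟨hinj, himm, himm', hinf⟩ := h1
  -- Part 2: the trivial-normal-bundle witness transfers from `S` to the embedded `C`
  have h2 := hC2 X JX u₀ v₀ N π u v F F₀ hu₀ hv₀ hglue₀ hinj₀ himm₀ himm₀' hinf₀
    hN hSN hπ hsubm hzero hu hv hglue hinj himm himm' hinf hF0 hF1 hF₀0 hF₀1 hhtp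
  exact ⟨⟨hinj, himm, himm', hinf⟩, h2⟩

end Literature.Geometry.Symplectic

end
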